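import Literature.AlgebraicGeometry.Resolution.CommonEtaleNeighbourhood
import Literature.AlgebraicGeometry.Resolution.SmoothPointsOnFibre
import Literature.AlgebraicGeometry.Resolution.NoetherianComponents
import Mathlib.AlgebraicGeometry.Morphisms.Proper
import Mathlib.AlgebraicGeometry.Noetherian
import HarnessLib

/-!
# De Jong 1996, 4.12: a good étale neighbourhood of a closed point of the base

Topic: `Literature/AlgebraicGeometry/Resolution`. The geometric preparation for the étaleness of
the finite part `Y' → ℙ^{d-1}` of the Stein factorisation of `f : X' → ℙ^{d-1}` (de Jong 1996,
4.12, p. 68: "Note that `Y' → ℙ^{d-1}` is (finite) étale, in view of property (ii) b) of the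
lemma"): around a closed point `y` of the base we produce (`exists_good_etale_nhd`) an étale
neighbourhood `g : U → Y` with

* `U` affine and CONNECTED, mapping into a given affine open `V ∋ y`;
* a `k`-point `pu` of `U` over the `k`-point at `y`;
* `Y`-morphisms `σᵢ : U → X` through finitely many prescribed smooth closed points `xᵢ` over
  `y` (sections of `X ×_Y U → U`; `exists_common_etale_nhd`);
* every irreducible component of `X ×_Y U` meeting the fibre over the point `u` of `pu`
  (`exists_isOpen_forall_mem_image_of_isClosedMap`, shrinking `U`).

The shrinking steps restrict `U` to opens containing `u` (`exists_lift_point`,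
`forall_mem_image_of_restrict`: irreducible components of `X ×_Y W` are traces of those of
`X ×_Y U`, `exists_preimage_eq_of_mem_irreducibleComponents`); connectedness is achieved on the
connected component of `u`, open and closed in the Noetherian `U`
(`isClopen_connectedComponent_of_noetherianSpace`) hence an affine basic open
(`exists_basicOpen_coe_eq_of_isClopen`). [folklore]; no definitions, no named facts.

## Sources

* A. J. de Jong, *Smoothness, semi-stability and alterations*, Publ. Math. IHÉS 83 (1996), 4.12,
  p. 68. [DeJong1996]
-/

noncomputable section

open CategoryTheory CategoryTheory.Limits AlgebraicGeometry TopologicalSpace Topology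

namespace Literature.AlgebraicGeometry.Resolution

universe u

/-! ## Restricting an étale neighbourhood to an open containing the point -/

/-- A point `p : Spec K → U` landing in an open `W` lifts to `W`. [folklore] -/
theorem exists_lift_point {K : Type u} [Field K] {U : Scheme.{u}} (pu : Spec (.of K) ⟶ U)
    (W : U.Opens) (hW : pu (IsLocalRing.closedPoint K) ∈ W) :
    ∃ pu' : Spec (.of K) ⟶ W, pu' ≫ W.ι = pu := by
  have hr : Set.range pu ⊆ Set.range W.ι := by
    rw [Scheme.Opens.range_ι]
    rintro _ ⟨a, rfl⟩
    rwa [Subsingleton.elim a (IsLocalRing.closedPoint K)]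
  exact ⟨IsOpenImmersion.lift W.ι pu hr, IsOpenImmersion.lift_fac _ _ _⟩

/-- **Components of `X ×_Y W` are traces of components of `X ×_Y U`** (`W ⊆ U` open): if every
irreducible component of `X ×_Y U` meeting the preimage of `W` has `u ∈ W` in its image, then
every irreducible component of `X ×_Y W` has `u` in its image. The comparison map
`X ×_Y W → X ×_Y U` is an open immersion (a base change of `W ↪ U`) with image the preimage of
`W`. [folklore] -/
theorem forall_mem_image_of_restrict {X Y U : Scheme.{u}} (f : X ⟶ Y) (g : U ⟶ Y)
    (W : U.Opens) (u : W)
    (hcomp : ∀ Z ∈ irreducibleComponents ↥(pullback f g),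
      (Z ∩ (pullback.snd f g) ⁻¹' (W : Set U)).Nonempty → (u : U) ∈ (pullback.snd f g) '' Z) :
    ∀ Z ∈ irreducibleComponents ↥(pullback f (W.ι ≫ g)),
      u ∈ (pullback.snd f (W.ι ≫ g)) '' Z := by
  -- the comparison map and its pullback square
  let j : pullback f (W.ι ≫ g) ⟶ pullback f g :=
    pullback.lift (pullback.fst f (W.ι ≫ g)) (pullback.snd f (W.ι ≫ g) ≫ W.ι)
      (by rw [pullback.condition, Category.assoc])
  have hj1 : j ≫ pullback.fst f g = pullback.fst f (W.ι ≫ g) := pullback.lift_fst _ _ _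
  have hj2 : j ≫ pullback.snd f g = pullback.snd f (W.ι ≫ g) ≫ W.ι := pullback.lift_snd _ _ _
  have sq : IsPullback j (pullback.snd f (W.ι ≫ g)) (pullback.snd f g) W.ι := by
    refine IsPullback.of_right ?_ hj2 (IsPullback.of_hasPullback f g)
    rw [hj1]
    exact IsPullback.of_hasPullback f (W.ι ≫ g)
  haveI : IsOpenImmersion j := MorphismProperty.of_isPullback (P := @IsOpenImmersion) sq.flip
    inferInstance
  intro Z' hZ'
  obtain ⟨Z, hZ, hZne, hZZ'⟩ :=
    exists_preimage_eq_of_mem_irreducibleComponents j.isOpenEmbedding hZ'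
  -- `Z` meets the preimage of `W`: the image of `j` lies over `W`
  have hZW : (Z ∩ (pullback.snd f g) ⁻¹' (W : Set U)).Nonempty := by
    obtain ⟨_, hzZ, z', rfl⟩ := hZne
    refine ⟨j z', hzZ, ?_⟩
    change (pullback.snd f g) (j z') ∈ W
    rw [← Scheme.Hom.comp_apply, hj2, Scheme.Hom.comp_apply]
    exact (pullback.snd f (W.ι ≫ g) z').2
  obtain ⟨z, hzZ, hzu⟩ := hcomp Z hZ hZW
  -- `z` lies over `u ∈ W`, hence in the image of `j`
  obtain ⟨z', hz'1, hz'2⟩ := Scheme.exists_preimage_of_isPullback sq z u (by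
    rw [hzu]; rfl)
  refine ⟨z', ?_, hz'2⟩
  rw [← hZZ']
  change j z' ∈ Z
  rwa [hz'1]

/-- In an affine scheme every clopen subset is a basic open (of an idempotent), in particular
an affine open. [folklore] -/
theorem exists_basicOpen_coe_eq_of_isClopen {S : Scheme.{u}} [IsAffine S] {C : Set S}
    (hC : IsClopen C) : ∃ e : Γ(S, ⊤), (S.basicOpen e : Set S) = C := by
  -- transport to `Spec Γ(S, ⊤)` along `S.isoSpec`
  let h := AlgebraicGeometry.Scheme.homeoOfIso S.isoSpec
  have hC' : IsClopen (h.symm ⁻¹' C) := hC.preimage h.symm.continuous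
  obtain ⟨e, -, he⟩ := PrimeSpectrum.isClopen_iff.mp hC'
  refine ⟨S.isoSpec.hom.appTop ((Scheme.ΓSpecIso Γ(S, ⊤)).inv e), ?_⟩
  have h1 : S.isoSpec.hom ⁻¹ᵁ (Spec Γ(S, ⊤)).basicOpen ((Scheme.ΓSpecIso Γ(S, ⊤)).inv e) =
      S.basicOpen (S.isoSpec.hom.appTop ((Scheme.ΓSpecIso Γ(S, ⊤)).inv e)) :=
    Scheme.preimage_basicOpen_top _ _
  have hC_eq : C = h ⁻¹' (PrimeSpectrum.basicOpen e : Set (PrimeSpectrum Γ(S, ⊤))) := by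
    rw [← he, ← Set.preimage_comp, Homeomorph.symm_comp_self, Set.preimage_id]
  rw [← h1, basicOpen_eq_of_affine, hC_eq]
  rfl

/-! ## The good étale neighbourhood -/

/-- Points of an open subscheme: the inclusion is injective with `W.ι w = w.1`. [folklore] -/
theorem apply_eq_of_comp_ι_eq {K : Type u} [Field K] {U : Scheme.{u}} {W : U.Opens}
    {pu : Spec (.of K) ⟶ U} {pu' : Spec (.of K) ⟶ W} (h : pu' ≫ W.ι = pu)
    (a : Spec (.of K)) (hm : pu a ∈ W) : pu' a = ⟨pu a, hm⟩ := by
  apply Subtype.ext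
  change (W.ι (pu' a)) = pu a
  rw [← Scheme.Hom.comp_apply, h]

/-- **De Jong 1996, 4.12 — a good étale neighbourhood of a closed point of the base.** Let
`f : X → Y` be proper and locally of finite presentation over an algebraically closed field
`k`, `y ∈ Y` a closed point, `V ∋ y` an affine open, and `xᵢ` finitely many closed points of `X`
over `y` in the smooth locus of `f`. There are an affine CONNECTED scheme `U`, an étale
`g : U → Y` mapping into `V`, a `k`-point `pu` of `U` over the `k`-point at `y`, `Y`-morphisms
`σᵢ : U → X` with `pu ≫ σᵢ` the `k`-point at `xᵢ`, and every irreducible component of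
`X ×_Y U` meets the fibre over the point of `pu`. [cite: DeJong1996, 4.12, p. 68] -/
theorem exists_good_etale_nhd {k : Type u} [Field k] [IsAlgClosed k] {X Y : Scheme.{u}}
    (gY : Y ⟶ Spec (.of k)) [LocallyOfFiniteType gY] (f : X ⟶ Y) [IsProper f]
    [LocallyOfFinitePresentation f] (y : Y) (hy : IsClosed ({y} : Set Y))
    (ι : Type u) [Finite ι] (x : ι → X) (hxs : ∀ i, x i ∈ f.smoothLocus)
    (hxc : ∀ i, IsClosed ({x i} : Set X))
    (hxy : ∀ i, pointOfClosedPoint (f ≫ gY) (x i) (hxc i) ≫ f = pointOfClosedPoint gY y hy)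
    (V : Y.Opens) (hyV : y ∈ V) :
    ∃ (U : Scheme.{u}) (_ : IsAffine U) (_ : ConnectedSpace U) (g : U ⟶ Y) (_ : Etale g)
      (pu : Spec (.of k) ⟶ U) (_ : (⊤ : U.Opens) ≤ g ⁻¹ᵁ V),
      pu ≫ g = pointOfClosedPoint gY y hy ∧
      (∀ i, ∃ σ : U ⟶ X, σ ≫ f = g ∧ pu ≫ σ = pointOfClosedPoint (f ≫ gY) (x i) (hxc i)) ∧
      ∀ Z ∈ irreducibleComponents ↥(pullback f g),
        pu (IsLocalRing.closedPoint k) ∈ (pullback.snd f g) '' Z := by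
  set pt := IsLocalRing.closedPoint k with hpt
  -- a common étale neighbourhood with sections through the `xᵢ`
  obtain ⟨U₀, g₀, hg₀, pu₀, hpu₀, hσ₀⟩ :=
    exists_common_etale_nhd gY f (pointOfClosedPoint gY y hy) ι x hxs hxc hxy
  choose σ₀ hσ₀f hσ₀p using hσ₀
  have hu₀ : g₀ (pu₀ pt) = y := by
    rw [← Scheme.Hom.comp_apply, hpu₀, pointOfClosedPoint_apply]
  -- (a) an affine open neighbourhood mapping into `V`
  obtain ⟨U₁, hU₁, hu₁, hU₁V⟩ := exists_isAffineOpen_mem_and_subset (x := pu₀ pt)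
    (U := g₀ ⁻¹ᵁ V) (show g₀ (pu₀ pt) ∈ V by rw [hu₀]; exact hyV)
  obtain ⟨pu₁, hpu₁⟩ := exists_lift_point pu₀ U₁ hu₁
  haveI : IsAffine U₁ := hU₁
  -- Noetherian bookkeeping
  haveI : IsLocallyNoetherian Y := LocallyOfFiniteType.isLocallyNoetherian gY
  haveI : IsLocallyNoetherian U₀ := LocallyOfFiniteType.isLocallyNoetherian g₀
  haveI : IsNoetherian (U₁ : Scheme.{u}) := ⟨⟩
  haveI : IsLocallyNoetherian (pullback f (U₁.ι ≫ g₀)) :=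
    LocallyOfFiniteType.isLocallyNoetherian (pullback.snd f (U₁.ι ≫ g₀))
  haveI : IsNoetherian (pullback f (U₁.ι ≫ g₀)) := ⟨⟩
  -- (b) shrink so that every component meets the fibre, then to a basic open
  obtain ⟨O, hO, huO, hOcomp⟩ := exists_isOpen_forall_mem_image_of_isClosedMap
    (NoetherianSpace.finite_irreducibleComponents (α := ↥(pullback f (U₁.ι ≫ g₀))))
    (pullback.snd f (U₁.ι ≫ g₀)).isClosedMap (pu₁ pt)
  obtain ⟨t₀, ht₀O, hut₀⟩ := (isAffineOpen_top (U₁ : Scheme.{u})).exists_basicOpen_le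
    (V := ⟨O, hO⟩) ⟨pu₁ pt, huO⟩ trivial
  set D₀ : (U₁ : Scheme.{u}).Opens := (U₁ : Scheme.{u}).basicOpen t₀ with hD₀
  obtain ⟨pu₂, hpu₂⟩ := exists_lift_point pu₁ D₀ hut₀
  have hpu₂pt : pu₂ pt = ⟨pu₁ pt, hut₀⟩ := apply_eq_of_comp_ι_eq hpu₂ pt hut₀
  have hcomp₂ : ∀ Z ∈ irreducibleComponents ↥(pullback f (D₀.ι ≫ U₁.ι ≫ g₀)),
      pu₂ pt ∈ (pullback.snd f (D₀.ι ≫ U₁.ι ≫ g₀)) '' Z := by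
    rw [hpu₂pt]
    exact forall_mem_image_of_restrict f (U₁.ι ≫ g₀) D₀ ⟨pu₁ pt, hut₀⟩
      (fun Z hZ hne => hOcomp Z hZ (hne.mono fun z hz => ⟨hz.1, ht₀O hz.2⟩))
  haveI : IsAffine D₀ := (isAffineOpen_top (U₁ : Scheme.{u})).basicOpen t₀
  haveI : IsNoetherian (D₀ : Scheme.{u}) := ⟨⟩
  -- (c) the connected component of the point is an affine (basic) open
  set g₂ : (D₀ : Scheme.{u}) ⟶ Y := D₀.ι ≫ U₁.ι ≫ g₀ with hg₂
  have hCclopen : IsClopen (connectedComponent (pu₂ pt)) :=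
    isClopen_connectedComponent_of_noetherianSpace (pu₂ pt)
  obtain ⟨ε, hε⟩ := exists_basicOpen_coe_eq_of_isClopen hCclopen
  set W : (D₀ : Scheme.{u}).Opens := (D₀ : Scheme.{u}).basicOpen ε with hW
  have huW : pu₂ pt ∈ W := by
    change pu₂ pt ∈ (W : Set (D₀ : Scheme.{u}))
    rw [hW, hε]
    exact mem_connectedComponent
  obtain ⟨pu₃, hpu₃⟩ := exists_lift_point pu₂ W huW
  have hpu₃pt : pu₃ pt = ⟨pu₂ pt, huW⟩ := apply_eq_of_comp_ι_eq hpu₃ pt huW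
  haveI : IsAffine W := (isAffineOpen_top (D₀ : Scheme.{u})).basicOpen ε
  have hconn : ConnectedSpace W := by
    have : ConnectedSpace (W : Set (D₀ : Scheme.{u})) := by
      rw [hW, hε]
      exact Subtype.connectedSpace isConnected_connectedComponent
    exact this
  refine ⟨W, inferInstance, hconn, W.ι ≫ g₂, inferInstance, pu₃, ?_, ?_, ?_, ?_⟩
  · -- into `V`
    intro w _
    change g₀ (U₁.ι (D₀.ι (W.ι w))) ∈ V
    apply hU₁V
    rw [Scheme.Opens.ι_apply]
    exact (D₀.ι (W.ι w)).2
  · -- over the `k`-point at `y`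
    rw [hg₂, ← Category.assoc, hpu₃, ← Category.assoc, hpu₂, ← Category.assoc, hpu₁, hpu₀]
  · -- sections
    intro i
    refine ⟨W.ι ≫ D₀.ι ≫ U₁.ι ≫ σ₀ i, ?_, ?_⟩
    · simp only [Category.assoc, hσ₀f, hg₂]
    · rw [← Category.assoc, hpu₃, ← Category.assoc, hpu₂, ← Category.assoc, hpu₁, hσ₀p]
  · -- components meet the fibre
    rw [hpu₃pt]
    exact forall_mem_image_of_restrict f g₂ W ⟨pu₂ pt, huW⟩ (fun Z hZ _ => hcomp₂ Z hZ)

end Literature.AlgebraicGeometry.Resolution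

end
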